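import Literature.AlgebraicGeometry.Frobenioids.BirationalizationBiratData
import Literature.AlgebraicGeometry.Frobenioids.BiratLocalization
import Literature.AlgebraicGeometry.Frobenioids.BiratUnitsAut
import Literature.AlgebraicGeometry.Frobenioids.BiratUnitsSubfunctor
import HarnessLib

/-!
# Frobenioids I, Proposition 4.4 (iii) at THE birationalization: the units `O^×(A^birat)`, their
# divisors, the kernel clause (all Frobenioids) and the surjectivity clause (isotropic type)

Mochizuki, *The geometry of Frobenioids I: the general theory*, Kyushu J. Math. **62** (2008)
293–400, §4, Proposition 4.4 (iii), kurims text p. 83, proof p. 85 last lines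
[cite: MochizukiFrdI2008, Prop. 4.4 (iii) p.83]: "the resulting functor `C^birat → F_{Φ^birat}` induces,
for each `A^birat ∈ Ob(C^birat)`, a surjection `O^×(A^birat) ↠ Φ^birat(A^birat)`, whose kernel is the
image, via the injection `O^▷(A)^gp ↪ O^×(A^birat)` of (ii), of `O^×(A) ⊆ O^▷(A)^gp`."

PROOF-ONLY file (theorems only) over seat abc-iut-L1-t3's typed statement
`PreFrobenioidData.Prop44iii` (`DivisorMonoidCategoryTheoreticityDefs.lean`) and THE birationalization
datum `PreFrobenioid.biratData hF hsq` of `BirationalizationBiratData.lean` (seats abc-iut-L6-t8 /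
abc-iut-L6-t6: `C^birat = Birat F hF hsq`, `biratOps` over `0_D`, `biratDivHom`, canonical
`Φ^birat = biratSubgroup F` of seat abc-iut-L1-t5). It identifies the unit group of `A^birat` for the
operations `C^birat → F_{0_D}` with abc-iut-L6-t8's group of rational functions `BiratUnits F hF A`
(`toAut` is onto `O^×(A^birat)`: a unit `[(α, φ′)]` has `φ′` a pre-step base-equivalent to `α`, hence a
co-angular pre-step by Def. 1.3 (iii)(b)), transports the divisor map along this identification
(`biratDivHom_toAut`), and concludes:
* `biratDivHom_eq_one_iff` — the KERNEL clause of Prop. 4.4 (iii) for every Frobenioid (Def. 1.3 (vi)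
  via abc-iut-L6-t8's `ker_divHom_eq_range`);
* `range_biratDivHom` — the IMAGE of `O^×(A^birat) → Φ^gp(Base A)` is the set of birational germs at `A`
  (every Frobenioid);
* `prop44iii_biratData_iff` — Prop. 4.4 (iii) as typed holds at `biratData hF hsq` iff the germs at
  every `A` exhaust `Φ^birat(Base A)`;
* `prop44iii_biratData`, `prop44iii_holds_of_isFrobenioid` — **Prop. 4.4 (iii) HOLDS at THE
  birationalization of every Frobenioid of ISOTROPIC type** (germs exhaust `Φ^birat` there, seat
  abc-iut-L1-t10's `coe_biratSubfunctor_baseObj`).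
For Frobenioids that are not of isotropic type the surjectivity clause can FAIL: see
`BirationalizationProp44iiiCounterexample.lean` (the two-level Frobenioid). No statement of the paper
is strengthened; nothing here bears on the disputed parts of [IUTchIII].
-/

namespace Literature.AlgebraicGeometry.Frobenioids

open CategoryTheory Opposite

namespace PreFrobenioid

universe w v v' u u'

variable {D : Type u} [Category.{v} D] {Φ : Dᵒᵖ ⥤ CommMonCat.{w}}
  {C : Type u'} [Category.{v'} C] {F : C ⥤ ElemFrobenioid Φ}
  {hF : IsFrobenioid F} {hsq : HasBiratSquares F} {A : C}

/-! ### The divisor of a fraction of units -/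

/-- For a fraction `(α, φ)` of co-angular pre-steps, the `Φ^gp`-divisor `Φ(α)⁻¹{Div φ − Div α}` of the
birational fraction equals abc-iut-L6-t8's `RatFrac.div (α, φ) = Φ(φ)⁻¹Div φ − Φ(α)⁻¹Div α`.
[cite: MochizukiFrdI2008, Prop. 4.4 (i) p.84] -/
theorem divGp_toBiratFrac (p : RatFrac F A) : BiratFrac.divGp p.toBiratFrac = RatFrac.div p := by
  haveI : IsIso (Base F p.den) := p.den_mem.2.2
  haveI : IsIso (Base F p.num) := p.num_mem.2.2
  have hdeg : (BiratFrac.deg p.toBiratFrac : ℕ) = 1 := by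
    change (degFr F p.num : ℕ) = 1; rw [p.num_mem.2.1]; rfl
  have key : pull Φ (inv (Base F p.den)) (Div F p.num) = invDiv F p.num p.num_mem.2.2 := by
    change pull Φ (inv (Base F p.den)) (Div F p.num) = pull Φ (inv (Base F p.num)) (Div F p.num)
    congr 2
    exact IsIso.inv_eq_inv.mpr p.baseEq
  rw [RatFrac.div, BiratFrac.divGp, hdeg, pow_one, map_div, pullGp_of', pullGp_of']
  change Algebra.GrothendieckGroup.of (pull Φ (inv (Base F p.den)) (Div F p.num)) /
      Algebra.GrothendieckGroup.of (pull Φ (inv (Base F p.den)) (Div F p.den)) = _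
  rw [key]
  rfl

/-! ### `O^×(A^birat)` is abc-iut-L6-t8's `BiratUnits F hF A` -/

/-- The automorphism `φ ∘ α⁻¹` of `A^birat` attached to a rational function is a UNIT for
`C^birat → F_{0_D}`: base-identity (`Base φ = Base α`) and linear (`deg_Fr φ = 1`).
[cite: MochizukiFrdI2008, Prop. 4.4 (iii) p.83] -/
theorem toAut_mem_unitsSubgroup (x : BiratUnits F hF A) :
    BiratUnits.toAut hsq x ∈ (biratOps hF hsq).unitsSubgroup ((toBirat F hF hsq).obj A) := by
  obtain ⟨p, rfl⟩ := BiratUnits.mk_surjective x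
  haveI : IsIso (Base F p.den) := p.den_mem.2.2
  refine ⟨?_, ?_⟩
  · change (biratOps hF hsq).base.map (Birat.homMk p.toBiratFrac) = 𝟙 _
    rw [biratOps_base_map_homMk]
    change inv (Base F p.den) ≫ Base F p.num = 𝟙 _
    rw [← p.baseEq, IsIso.inv_hom_id]
  · change (biratOps hF hsq).degFr (Birat.homMk p.toBiratFrac) = 1
    rw [biratOps_degFr_homMk]
    exact p.num_mem.2.1

variable (hsq) in
/-- `O^×(A^birat)` as the image of abc-iut-L6-t8's `BiratUnits`: the unit of `A^birat` defined by a
rational function. [cite: MochizukiFrdI2008, Prop. 4.4 (iii) p.83] -/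
theorem exists_toAut_eq (u : (biratOps hF hsq).unitsSubgroup ((toBirat F hF hsq).obj A)) :
    ∃ x : BiratUnits F hF A, BiratUnits.toAut hsq x = u.1 := by
  obtain ⟨f, hf⟩ := Birat.homMk_surjective u.1.hom
  obtain ⟨hnum, hb⟩ := isPreStep_num_of_mem_unitsSubgroup u f hf
  have hnum' : IsCoAngularPreStep F f.num := ⟨hF.iii_b f.den f.den_mem f.num, hnum⟩
  refine ⟨BiratUnits.mk hF ⟨f.src, f.den, f.num, f.den_mem, hnum', hb⟩, ?_⟩
  apply Iso.ext
  rw [BiratUnits.toAut_hom, BiratUnits.toHom_mk]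
  exact hf

/-- Every unit of `A^birat` is `toAut` of a rational function (surjectivity of
`BiratUnits → O^×(A^birat)`; with `toAut_injective` this is a bijection).
[cite: MochizukiFrdI2008, Prop. 4.4 (iii) p.83] -/
theorem toAut_surjective_unitsSubgroup :
    Function.Surjective (fun x : BiratUnits F hF A =>
      (⟨BiratUnits.toAut hsq x, toAut_mem_unitsSubgroup x⟩ :
        (biratOps hF hsq).unitsSubgroup ((toBirat F hF hsq).obj A))) := by
  intro u
  obtain ⟨x, hx⟩ := exists_toAut_eq hsq u
  exact ⟨x, Subtype.ext hx⟩

/-- The divisor map of Prop. 4.4 (iii) on the unit of a rational function is abc-iut-L6-t8's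
`divHom`. [cite: MochizukiFrdI2008, Prop. 4.4 (iii) p.83] -/
theorem biratDivHom_toAut (x : BiratUnits F hF A) :
    biratDivHom hF hsq A ⟨BiratUnits.toAut hsq x, toAut_mem_unitsSubgroup x⟩ =
      BiratUnits.divHom hF A x := by
  obtain ⟨p, rfl⟩ := BiratUnits.mk_surjective x
  rw [biratDivHom_apply_of_eq _ p.toBiratFrac rfl, divGp_toBiratFrac]
  rfl

/-! ### Prop. 4.4 (iii): the kernel (every Frobenioid) -/

variable (hsq) in
/-- **Prop. 4.4 (iii), kernel clause, for EVERY Frobenioid**: a unit of `A^birat` has trivial divisor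
iff it is the image under `C → C^birat` of a unit of `A` (Def. 1.3 (vi), through abc-iut-L6-t8's
`ker_divHom_eq_range`). [cite: MochizukiFrdI2008, Prop. 4.4 (iii) p.83] -/
theorem biratDivHom_eq_one_iff (u : (biratOps hF hsq).unitsSubgroup ((toBirat F hF hsq).obj A)) :
    biratDivHom hF hsq A u = 1 ↔
      ∃ α : Aut A, α ∈ unitsSubgroup F A ∧ (toBirat F hF hsq).mapIso α =
        (u : Aut ((toBirat F hF hsq).obj A)) := by
  obtain ⟨x, hx⟩ := toAut_surjective_unitsSubgroup (hsq := hsq) u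
  subst hx
  rw [biratDivHom_toAut]
  constructor
  · intro h
    have hmem : x ∈ (BiratUnits.divHom hF A).ker := h
    rw [BiratUnits.ker_divHom_eq_range] at hmem
    obtain ⟨α, rfl⟩ := hmem
    refine ⟨α.1, α.2, ?_⟩
    apply Iso.ext
    exact (BiratUnits.toHom_unitsToBirat_spec (hsq := hsq) α).symm
  · rintro ⟨α, hα, he⟩
    have hx : x = BiratUnits.unitsToBirat hF A ⟨α, hα⟩ := by
      apply BiratUnits.toAut_injective (hsq := hsq)
      apply Iso.ext
      rw [BiratUnits.toAut_hom, BiratUnits.toAut_hom]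
      change _ = BiratUnits.toHom hsq (BiratUnits.mk hF _)
      rw [show BiratUnits.toHom hsq (BiratUnits.mk hF (BiratUnits.unitFrac hF A ⟨α, hα⟩)) =
          (toBirat F hF hsq).map α.hom from BiratUnits.toHom_unitsToBirat_spec (hsq := hsq) ⟨α, hα⟩]
      have he' := congrArg Iso.hom he
      exact he'.symm
    rw [hx]
    exact BiratUnits.divHom_unitsToBirat ⟨α, hα⟩

/-! ### Prop. 4.4 (iii): the image (every Frobenioid) and the surjectivity (isotropic type) -/

variable (hsq A) in
/-- The IMAGE of `O^×(A^birat) → Φ^gp(Base A)` is the set of birational germs at `A`, for every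
Frobenioid. [cite: MochizukiFrdI2008, Prop. 4.4 (iii) p.83] -/
theorem range_biratDivHom : Set.range (biratDivHom hF hsq A) = biratGerms F A := by
  rw [← BiratUnits.coe_divHomRange_eq_biratGerms hF A]
  ext y
  constructor
  · rintro ⟨u, rfl⟩
    obtain ⟨x, rfl⟩ := toAut_surjective_unitsSubgroup (hsq := hsq) u
    rw [biratDivHom_toAut]
    exact ⟨x, rfl⟩
  · rintro ⟨x, rfl⟩
    exact ⟨_, biratDivHom_toAut x⟩

variable (hsq A) in
/-- A value is the divisor of a unit of `A^birat` iff it is the divisor of a rational function of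
abc-iut-L6-t8. [cite: MochizukiFrdI2008, Prop. 4.4 (iii) p.83] -/
theorem exists_biratDivHom_eq_iff (y : Algebra.GrothendieckGroup (Φ.obj (op (baseObj F A)))) :
    (∃ u, biratDivHom hF hsq A u = y) ↔ ∃ x : BiratUnits F hF A, BiratUnits.divHom hF A x = y := by
  constructor
  · rintro ⟨u, rfl⟩
    obtain ⟨x, rfl⟩ := toAut_surjective_unitsSubgroup (hsq := hsq) u
    exact ⟨x, (biratDivHom_toAut x).symm⟩
  · rintro ⟨x, rfl⟩
    exact ⟨_, biratDivHom_toAut x⟩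

variable (hF hsq) in
/-- Prop. 4.4 (iii) AS TYPED (`Prop44iii`) holds at THE birationalization `biratData hF hsq` iff, at
every object `A`, every element of the canonical `Φ^birat(Base A)` (seat abc-iut-L1-t5's generated
subfunctor) is the divisor of a rational function at `A` — the kernel clause being automatic.
[cite: MochizukiFrdI2008, Prop. 4.4 (iii) p.83] -/
theorem prop44iii_biratData_iff :
    PreFrobenioidData.Prop44iii (biratData hF hsq) ↔
      ∀ (A : C), ∀ y ∈ biratSubgroup F (baseObj F A),
        ∃ x : BiratUnits F hF A, BiratUnits.divHom hF A x = y := by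
  constructor
  · intro h A y hy
    exact (exists_biratDivHom_eq_iff hsq A y).mp ((h A).1 y hy)
  · intro h A
    exact ⟨fun y hy => (exists_biratDivHom_eq_iff hsq A y).mpr (h A y hy),
      fun u => biratDivHom_eq_one_iff hsq u⟩

variable (hF hsq) in
/-- **[FrdI] Prop. 4.4 (iii) HOLDS at THE birationalization of a Frobenioid of ISOTROPIC type**
(`Prop44iii (biratData hF hsq)`): `O^×(A^birat) ↠ Φ^birat(Base A)` is onto the canonical `Φ^birat`
(abc-iut-L1-t10: germs exhaust `Φ^birat` at base objects in isotropic type) with kernel the image of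
`O^×(A)`. [cite: MochizukiFrdI2008, Prop. 4.4 (iii) p.83] -/
theorem prop44iii_biratData (hiso : IsOfIsotropicType F) :
    PreFrobenioidData.Prop44iii (biratData hF hsq) :=
  (prop44iii_biratData_iff hF hsq).mpr fun A y hy =>
    BiratUnits.divHom_surjective_biratSubgroup hF A hiso y hy

variable (hF) in
/-- **[FrdI] Prop. 4.4 (iii) for every Frobenioid of isotropic type**, unconditionally in the
composition squares (abc-iut-L1-t3's `Prop44iii` at `biratData hF (hasBiratSquares_of_isFrobenioid hF)`).
[cite: MochizukiFrdI2008, Prop. 4.4 (iii) p.83] -/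
theorem prop44iii_holds_of_isFrobenioid (hiso : IsOfIsotropicType F) :
    PreFrobenioidData.Prop44iii (biratData hF (hasBiratSquares_of_isFrobenioid hF)) :=
  prop44iii_biratData hF _ hiso

end PreFrobenioid

end Literature.AlgebraicGeometry.Frobenioids
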